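import Mathlib
import HarnessLib
import Summits.Ventures.LatticeQCDFlow.Exactness.U1FTHMCFiguresOfMerit
import Summits.Ventures.LatticeQCDFlow.Exactness.U1WilsonFlowLOMemberFTHMCN

/-!
# FT-HMC through the engine's `U(1)` leading-order Wilson-flow member (any layer schedule), as run: every event has a finite `τ_int` (one constant), certified burn-in, and asymptotically exact batch-means error bars from EVERY start — short trajectories

HONEST FRAMING: exact (Metropolis-corrected) sampling algorithms for lattice gauge theory;
figures of merit are autocorrelation/cost numbers at stated couplings and volumes; no
continuum-physics claim.

Venture `LatticeQCDFlow` (cell pub-lqcd), topic `Exactness`, FANOUT row 9 (eng-latcore, GEN-23; kernel family B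
`latflow.fthmc` / `flows`: the `U(1)` leading-order Wilson-flow coupling layers on a proper site colouring, composed
along ANY schedule of (direction, colour) pairs, as the trivializing map of an FT-HMC — the venture's STEP-0 rung).
NEW WORK of the cell over the tree, nothing cited as a fact, no number claimed: row 9's
`U1WilsonFlowLOMemberFTHMCN.lean` (`u1WilsonFlowLO_member_fthmcN_uniformlyErgodic` — TV convergence through the
member; `exists_layers_u1WilsonFlowLO`, `hasJacobian_foldr_trans`, `u1WilsonFlowLO_layers_pinched`,
`foldr_logDet_mem_Icc`), GEN-23's `U1FTHMCFiguresOfMerit.lean` (`u1LeapfrogFTHMCN_tauInt_setACF_le`,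
`u1LeapfrogFTHMCN_timeAverage_bias_le`, `u1LeapfrogFTHMCN_batchMeans_coverage`).  Printed counterparts NAMED ONLY:
Lüscher 2010; Kanwar et al. 2020 (`U(1)` gauge-equivariant flows); Meyn–Tweedie 1993; Flegal–Jones 2010.

## Content (torus `(ℤ/L)^d`, proper colouring `χ`, layer step `2(d−1)|ε| < 1`, ANY schedule `sched`; any
## measurable `|S| ≤ s'`; `n ≥ 1` leapfrog steps of size `ε' > 0`, `κ' > 0`, increment `g` measurable, `K`-Lipschitz,
## bounded by `b'`, `4 K ε' n² ≤ 3`; the layers are produced VERBATIM as the engine's formulas — the `layers.map` clause)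

* **`u1WilsonFlowLO_member_fthmcN_tauInt_setACF_le`** — ONE `B ≥ 0` with `τ_int(1_A) ≤ 1/2 + B/(1 − π(A))` for EVERY
  event `A` with `0 < π(A) < 1` (`π = u1GibbsLaw S`), for the member's reported `n`-step FT-HMC chain.
* **`u1WilsonFlowLO_member_fthmcN_timeAverage_bias_le`** — ONE `B ≥ 0`: burn-in bias ≤ `B/N'` from EVERY start.
* **`u1WilsonFlowLO_member_fthmcN_batchMeans_coverage`** — `σ²_f > 0`, `z > 0`, any start: the studentised
  batch-means interval of every bounded measurable observable has asymptotically exact coverage.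

NOT CLAIMED: that the flow member HELPS (constants are existential); longer trajectories; the Lipschitz constant of
the member's pulled-back force (taken as the hypothesis on `g`, like the parent file); floating point.
-/

noncomputable section

namespace Summit.Ventures.LatticeQCDFlow.Exactness

open MeasureTheory ProbabilityTheory ProbabilityTheory.Kernel Set Function Filter Topology
open Literature.MathematicalPhysics.QuantumFieldTheory
open Summit.Ventures.LatticeQCDFlow.Scoring (replicaSEsq tauInt)
open scoped ENNReal NNReal

section U1LO

variable {d L : ℕ} {X : Type*} [DecidableEq X] (χ : Site d L → X) [NeZero L]

/-- **EVERY EVENT HAS A FINITE `τ_int` UNDER THE `U(1)` LO WILSON-FLOW MEMBER'S FT-HMC AS RUN — ONE CONSTANT FOR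
ALL EVENTS** (any schedule; short trajectories): the layers are the engine's (the `layers.map` clause), and for the
reported `n`-step chain through their composition there is `B ≥ 0` with `τ_int(1_A) ≤ 1/2 + B/(1 − π(A))` for EVERY
measurable `A` with `0 < π(A) < 1`. -/
theorem u1WilsonFlowLO_member_fthmcN_tauInt_setACF_le
    (hχ : ∀ (x : Site d L) (i : Fin d), χ (x.shift i) ≠ χ x) {ε : ℝ}
    (hε : |ε| * (2 * ((d - 1 : ℕ) : ℝ)) < 1) (sched : List (Fin d × X))
    {ε' κ' : ℝ} (hε' : 0 < ε') (hκ' : 0 < κ') {n : ℕ} (hn : 1 ≤ n)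
    {g : GaugeConfig d L Circle → Edge d L → ℝ} (hg : Measurable g) {K : ℝ≥0}
    (hgK : LipschitzWith K g) (hshort : 4 * (K : ℝ) * ε' * (n : ℝ) ^ 2 ≤ 3) {b' : ℝ} (hb0 : 0 ≤ b')
    (hb : ∀ u l, ‖g u l‖ ≤ b')
    {S : GaugeConfig d L Circle → ℝ} (hS : Measurable S) {s' : ℝ} (hs : ∀ u, |S u| ≤ s') :
    ∃ layers : List ((GaugeConfig d L Circle ≃ᵐ GaugeConfig d L Circle) × (GaugeConfig d L Circle → ℝ)),
      layers.map (fun Ly => ((Ly.1 : GaugeConfig d L Circle → GaugeConfig d L Circle), Ly.2)) = sched.map (fun s =>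
        ((fun (V : GaugeConfig d L Circle) (e : Edge d L) => if e.2 = s.1 ∧ χ e.1 = s.2 then
          V e * Circle.exp (ε * ∑ ν ∈ Finset.univ.erase e.2,
            (((plaquetteHolonomy V (e.1 - Pi.single ν 1) e.2 ν : Circle) : ℂ).im -
              ((plaquetteHolonomy V e.1 e.2 ν : Circle) : ℂ).im)) else V e),
         fun V : GaugeConfig d L Circle => ∏ a : {e : Edge d L // e.2 = s.1 ∧ χ e.1 = s.2},
          (1 - ε * ∑ ν ∈ Finset.univ.erase a.1.2,
            (((plaquetteHolonomy V a.1.1 a.1.2 ν : Circle) : ℂ).re +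
              ((plaquetteHolonomy V (a.1.1 - Pi.single ν 1) a.1.2 ν : Circle) : ℂ).re)))) ∧
      ∃ B : ℝ, 0 ≤ B ∧ ∀ A : Set (GaugeConfig d L Circle), MeasurableSet A →
        0 < (u1GibbsLaw S).real A → (u1GibbsLaw S).real A < 1 →
        tauInt (setACF (conjKernel (u1LeapfrogHMCN ε' κ' hg (fun V =>
                  S ((layers.foldr (fun Ly (F : GaugeConfig d L Circle ≃ᵐ GaugeConfig d L Circle) =>
                  Ly.1.trans F) (MeasurableEquiv.refl (GaugeConfig d L Circle))) V) -
                    Real.log ((layers.foldr (fun Ly K => fun v => Ly.2 v * K (Ly.1 v))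
                      (fun _ => (1 : ℝ))) V)) n)
                (layers.foldr (fun Ly (F : GaugeConfig d L Circle ≃ᵐ GaugeConfig d L Circle) =>
                  Ly.1.trans F) (MeasurableEquiv.refl (GaugeConfig d L Circle)))) (u1GibbsLaw S) A) ≤ 1 / 2 + B / (1 - (u1GibbsLaw S).real A) := by
  obtain ⟨layers, hmap, hpos, hmeas, hjac⟩ := exists_layers_u1WilsonFlowLO χ hχ hε sched
  refine ⟨layers, hmap, ?_⟩
  obtain ⟨-, hfmeas, hfjac⟩ := hasJacobian_foldr_trans layers hpos hmeas hjac
  have hpinch := u1WilsonFlowLO_layers_pinched χ hε.le sched layers hmap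
  have h0 : 0 < 1 - |ε| * (2 * ((d - 1 : ℕ) : ℝ)) := by linarith
  have hfold := fun v => foldr_logDet_mem_Icc layers (pow_nonneg h0.le _) hpinch v
  haveI : Fact (0 < κ') := ⟨hκ'⟩
  have hSt : Measurable fun V : GaugeConfig d L Circle => S ((layers.foldr (fun Ly (F : GaugeConfig d L Circle ≃ᵐ GaugeConfig d L Circle) =>
                  Ly.1.trans F) (MeasurableEquiv.refl (GaugeConfig d L Circle))) V) - Real.log ((layers.foldr (fun Ly K => fun v => Ly.2 v * K (Ly.1 v))
                      (fun _ => (1 : ℝ))) V) :=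
    (hS.comp (MeasurableEquiv.measurable _)).sub (Real.measurable_log.comp hfmeas)
  haveI : Fact (Measurable fun z : (GaugeConfig d L Circle) × (Edge d L → ℝ) =>
      (S ((layers.foldr (fun Ly (F : GaugeConfig d L Circle ≃ᵐ GaugeConfig d L Circle) =>
                  Ly.1.trans F) (MeasurableEquiv.refl (GaugeConfig d L Circle))) z.1) - Real.log ((layers.foldr (fun Ly K => fun v => Ly.2 v * K (Ly.1 v))
                      (fun _ => (1 : ℝ))) z.1)) + u1Kinetic κ' z.2) :=
    ⟨(hSt.comp measurable_fst).add ((measurable_u1Kinetic κ').comp measurable_snd)⟩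
  haveI : IsMarkovKernel (u1LeapfrogHMCN ε' κ' hg (fun V =>
                  S ((layers.foldr (fun Ly (F : GaugeConfig d L Circle ≃ᵐ GaugeConfig d L Circle) =>
                  Ly.1.trans F) (MeasurableEquiv.refl (GaugeConfig d L Circle))) V) -
                    Real.log ((layers.foldr (fun Ly K => fun v => Ly.2 v * K (Ly.1 v))
                      (fun _ => (1 : ℝ))) V)) n) := by
    unfold u1LeapfrogHMCN; infer_instance
  exact u1LeapfrogFTHMCN_tauInt_setACF_le hε' hκ' hn hg hgK hshort hb0 hb hS hs (pow_pos (pow_pos h0 _) _)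
    (fun v => (hfold v).1) (fun v => (hfold v).2) hfmeas hfjac

/-- **CERTIFIED BURN-IN OF THE `U(1)` LO WILSON-FLOW MEMBER'S FT-HMC FROM EVERY START**: one `B ≥ 0` with
`|E_{μ₀}[(1/N') Σ_{t<N'} q(U_t)] − ∫ q dπ| ≤ B/N'` for EVERY initial law, every `[0,1]`-valued measurable `q`, `N' ≥ 1`. -/
theorem u1WilsonFlowLO_member_fthmcN_timeAverage_bias_le
    (hχ : ∀ (x : Site d L) (i : Fin d), χ (x.shift i) ≠ χ x) {ε : ℝ}
    (hε : |ε| * (2 * ((d - 1 : ℕ) : ℝ)) < 1) (sched : List (Fin d × X))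
    {ε' κ' : ℝ} (hε' : 0 < ε') (hκ' : 0 < κ') {n : ℕ} (hn : 1 ≤ n)
    {g : GaugeConfig d L Circle → Edge d L → ℝ} (hg : Measurable g) {K : ℝ≥0}
    (hgK : LipschitzWith K g) (hshort : 4 * (K : ℝ) * ε' * (n : ℝ) ^ 2 ≤ 3) {b' : ℝ} (hb0 : 0 ≤ b')
    (hb : ∀ u l, ‖g u l‖ ≤ b')
    {S : GaugeConfig d L Circle → ℝ} (hS : Measurable S) {s' : ℝ} (hs : ∀ u, |S u| ≤ s') :
    ∃ layers : List ((GaugeConfig d L Circle ≃ᵐ GaugeConfig d L Circle) × (GaugeConfig d L Circle → ℝ)),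
      layers.map (fun Ly => ((Ly.1 : GaugeConfig d L Circle → GaugeConfig d L Circle), Ly.2)) = sched.map (fun s =>
        ((fun (V : GaugeConfig d L Circle) (e : Edge d L) => if e.2 = s.1 ∧ χ e.1 = s.2 then
          V e * Circle.exp (ε * ∑ ν ∈ Finset.univ.erase e.2,
            (((plaquetteHolonomy V (e.1 - Pi.single ν 1) e.2 ν : Circle) : ℂ).im -
              ((plaquetteHolonomy V e.1 e.2 ν : Circle) : ℂ).im)) else V e),
         fun V : GaugeConfig d L Circle => ∏ a : {e : Edge d L // e.2 = s.1 ∧ χ e.1 = s.2},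
          (1 - ε * ∑ ν ∈ Finset.univ.erase a.1.2,
            (((plaquetteHolonomy V a.1.1 a.1.2 ν : Circle) : ℂ).re +
              ((plaquetteHolonomy V (a.1.1 - Pi.single ν 1) a.1.2 ν : Circle) : ℂ).re)))) ∧
      ∀ [IsMarkovKernel (u1LeapfrogHMCN ε' κ' hg (fun V =>
                  S ((layers.foldr (fun Ly (F : GaugeConfig d L Circle ≃ᵐ GaugeConfig d L Circle) =>
                  Ly.1.trans F) (MeasurableEquiv.refl (GaugeConfig d L Circle))) V) -
                    Real.log ((layers.foldr (fun Ly K => fun v => Ly.2 v * K (Ly.1 v))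
                      (fun _ => (1 : ℝ))) V)) n)],
      ∃ B : ℝ, 0 ≤ B ∧ ∀ (μ₀ : Measure (GaugeConfig d L Circle)) [IsProbabilityMeasure μ₀]
        (q : GaugeConfig d L Circle → ℝ), Measurable q → (∀ U, 0 ≤ q U) → (∀ U, q U ≤ 1) → ∀ N' : ℕ, N' ≠ 0 →
        |∫ x, (∑ t ∈ Finset.range N', q (x t)) / N'
            ∂(Kernel.trajMeasure (X := fun _ : ℕ => GaugeConfig d L Circle) μ₀
              (fun t : ℕ => (conjKernel (u1LeapfrogHMCN ε' κ' hg (fun V =>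
                  S ((layers.foldr (fun Ly (F : GaugeConfig d L Circle ≃ᵐ GaugeConfig d L Circle) =>
                  Ly.1.trans F) (MeasurableEquiv.refl (GaugeConfig d L Circle))) V) -
                    Real.log ((layers.foldr (fun Ly K => fun v => Ly.2 v * K (Ly.1 v))
                      (fun _ => (1 : ℝ))) V)) n)
                (layers.foldr (fun Ly (F : GaugeConfig d L Circle ≃ᵐ GaugeConfig d L Circle) =>
                  Ly.1.trans F) (MeasurableEquiv.refl (GaugeConfig d L Circle)))).comap
                (fun h : (i : ↥(Finset.Iic t)) → GaugeConfig d L Circle =>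
                  h ⟨t, Finset.mem_Iic.2 le_rfl⟩) (measurable_pi_apply _)))
          - ∫ U, q U ∂(u1GibbsLaw S)| ≤ B / N' := by
  obtain ⟨layers, hmap, hpos, hmeas, hjac⟩ := exists_layers_u1WilsonFlowLO χ hχ hε sched
  refine ⟨layers, hmap, ?_⟩
  obtain ⟨-, hfmeas, hfjac⟩ := hasJacobian_foldr_trans layers hpos hmeas hjac
  have hpinch := u1WilsonFlowLO_layers_pinched χ hε.le sched layers hmap
  have h0 : 0 < 1 - |ε| * (2 * ((d - 1 : ℕ) : ℝ)) := by linarith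
  have hfold := fun v => foldr_logDet_mem_Icc layers (pow_nonneg h0.le _) hpinch v
  intro _
  exact u1LeapfrogFTHMCN_timeAverage_bias_le hε' hκ' hn hg hgK hshort hb0 hb hS hs (pow_pos (pow_pos h0 _) _)
    (fun v => (hfold v).1) (fun v => (hfold v).2) hfmeas hfjac

/-- **THE BATCH-MEANS INTERVAL OF A `U(1)` LO WILSON-FLOW FT-HMC RUN IS ASYMPTOTICALLY EXACT** (`|f| ≤ C` measurable,
`σ²_f > 0`, `a, b → ∞`, any initial law, `z > 0`): `P_{μ₀}(|√(ab) (f̄_{ab} − π f)| ≤ z σ̂_BM) → (gaussianReal 0 1)[−z, z]`. -/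
theorem u1WilsonFlowLO_member_fthmcN_batchMeans_coverage
    (hχ : ∀ (x : Site d L) (i : Fin d), χ (x.shift i) ≠ χ x) {ε : ℝ}
    (hε : |ε| * (2 * ((d - 1 : ℕ) : ℝ)) < 1) (sched : List (Fin d × X))
    {ε' κ' : ℝ} (hε' : 0 < ε') (hκ' : 0 < κ') {n : ℕ} (hn : 1 ≤ n)
    {g : GaugeConfig d L Circle → Edge d L → ℝ} (hg : Measurable g) {K : ℝ≥0}
    (hgK : LipschitzWith K g) (hshort : 4 * (K : ℝ) * ε' * (n : ℝ) ^ 2 ≤ 3) {b' : ℝ} (hb0 : 0 ≤ b')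
    (hb : ∀ u l, ‖g u l‖ ≤ b')
    {S : GaugeConfig d L Circle → ℝ} (hS : Measurable S) {s' : ℝ} (hs : ∀ u, |S u| ≤ s') :
    ∃ layers : List ((GaugeConfig d L Circle ≃ᵐ GaugeConfig d L Circle) × (GaugeConfig d L Circle → ℝ)),
      layers.map (fun Ly => ((Ly.1 : GaugeConfig d L Circle → GaugeConfig d L Circle), Ly.2)) = sched.map (fun s =>
        ((fun (V : GaugeConfig d L Circle) (e : Edge d L) => if e.2 = s.1 ∧ χ e.1 = s.2 then
          V e * Circle.exp (ε * ∑ ν ∈ Finset.univ.erase e.2,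
            (((plaquetteHolonomy V (e.1 - Pi.single ν 1) e.2 ν : Circle) : ℂ).im -
              ((plaquetteHolonomy V e.1 e.2 ν : Circle) : ℂ).im)) else V e),
         fun V : GaugeConfig d L Circle => ∏ a : {e : Edge d L // e.2 = s.1 ∧ χ e.1 = s.2},
          (1 - ε * ∑ ν ∈ Finset.univ.erase a.1.2,
            (((plaquetteHolonomy V a.1.1 a.1.2 ν : Circle) : ℂ).re +
              ((plaquetteHolonomy V (a.1.1 - Pi.single ν 1) a.1.2 ν : Circle) : ℂ).re)))) ∧
      ∀ [IsMarkovKernel (u1LeapfrogHMCN ε' κ' hg (fun V =>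
                  S ((layers.foldr (fun Ly (F : GaugeConfig d L Circle ≃ᵐ GaugeConfig d L Circle) =>
                  Ly.1.trans F) (MeasurableEquiv.refl (GaugeConfig d L Circle))) V) -
                    Real.log ((layers.foldr (fun Ly K => fun v => Ly.2 v * K (Ly.1 v))
                      (fun _ => (1 : ℝ))) V)) n)],
      ∀ (f : GaugeConfig d L Circle → ℝ), Measurable f → ∀ C : ℝ, (∀ U, |f U| ≤ C) →
        0 < (∫ y, (f y - ∫ z, f z ∂(u1GibbsLaw S)) ^ 2 ∂(u1GibbsLaw S))
              + 2 * ∑' k, ∫ y, (f y - ∫ z, f z ∂(u1GibbsLaw S))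
                * (Scoring.kop (conjKernel (u1LeapfrogHMCN ε' κ' hg (fun V =>
                  S ((layers.foldr (fun Ly (F : GaugeConfig d L Circle ≃ᵐ GaugeConfig d L Circle) =>
                  Ly.1.trans F) (MeasurableEquiv.refl (GaugeConfig d L Circle))) V) -
                    Real.log ((layers.foldr (fun Ly K => fun v => Ly.2 v * K (Ly.1 v))
                      (fun _ => (1 : ℝ))) V)) n)
                (layers.foldr (fun Ly (F : GaugeConfig d L Circle ≃ᵐ GaugeConfig d L Circle) =>
                  Ly.1.trans F) (MeasurableEquiv.refl (GaugeConfig d L Circle)))))^[k + 1]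
                  (fun y => f y - ∫ z, f z ∂(u1GibbsLaw S)) y ∂(u1GibbsLaw S) →
      ∀ (μ₀ : Measure (GaugeConfig d L Circle)) [IsProbabilityMeasure μ₀] (a b'' : ℕ → ℕ),
        Tendsto a atTop atTop → Tendsto b'' atTop atTop → ∀ z : ℝ, 0 < z →
        Tendsto (fun N' : ℕ => (Kernel.trajMeasure (X := fun _ : ℕ => GaugeConfig d L Circle) μ₀
              (fun t : ℕ => (conjKernel (u1LeapfrogHMCN ε' κ' hg (fun V =>
                  S ((layers.foldr (fun Ly (F : GaugeConfig d L Circle ≃ᵐ GaugeConfig d L Circle) =>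
                  Ly.1.trans F) (MeasurableEquiv.refl (GaugeConfig d L Circle))) V) -
                    Real.log ((layers.foldr (fun Ly K => fun v => Ly.2 v * K (Ly.1 v))
                      (fun _ => (1 : ℝ))) V)) n)
                (layers.foldr (fun Ly (F : GaugeConfig d L Circle ≃ᵐ GaugeConfig d L Circle) =>
                  Ly.1.trans F) (MeasurableEquiv.refl (GaugeConfig d L Circle)))).comap
                (fun h : (i : ↥(Finset.Iic t)) → GaugeConfig d L Circle =>
                  h ⟨t, Finset.mem_Iic.2 le_rfl⟩) (measurable_pi_apply _))).real
          {x | |((Real.sqrt ((b'' N' * a N' : ℕ) : ℝ))⁻¹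
              * ∑ t ∈ Finset.range (b'' N' * a N'), (f (x t) - ∫ z, f z ∂(u1GibbsLaw S)))
            / Real.sqrt (((b'' N' * a N' : ℕ) : ℝ)
              * replicaSEsq (fun j (x : ℕ → GaugeConfig d L Circle) =>
                  (∑ i ∈ Finset.range (b'' N'), f (x (b'' N' * j + i))) / (b'' N')) (a N') x)| ≤ z})
          atTop (𝓝 ((gaussianReal 0 1).real (Set.Icc (-z) z))) := by
  obtain ⟨layers, hmap, hpos, hmeas, hjac⟩ := exists_layers_u1WilsonFlowLO χ hχ hε sched
  refine ⟨layers, hmap, ?_⟩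
  obtain ⟨-, hfmeas, hfjac⟩ := hasJacobian_foldr_trans layers hpos hmeas hjac
  have hpinch := u1WilsonFlowLO_layers_pinched χ hε.le sched layers hmap
  have h0 : 0 < 1 - |ε| * (2 * ((d - 1 : ℕ) : ℝ)) := by linarith
  have hfold := fun v => foldr_logDet_mem_Icc layers (pow_nonneg h0.le _) hpinch v
  intro _ f hf C hC hσ μ₀ _ a b'' ha hb'' z hz
  exact u1LeapfrogFTHMCN_batchMeans_coverage hε' hκ' hn hg hgK hshort hb0 hb hS hs (pow_pos (pow_pos h0 _) _)
    (fun v => (hfold v).1) (fun v => (hfold v).2) hfmeas hfjac hf hC hσ μ₀ ha hb'' hz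

end U1LO

end Summit.Ventures.LatticeQCDFlow.Exactness

end
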